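import Mathlib
import HarnessLib
import Summits.HubbardSuperconductivity.HubbardSuperconductivity.Theorems.KLProgrammeKLRegimeEngineV8DefsG11
import Summits.HubbardSuperconductivity.HubbardSuperconductivity.Theorems.KLProgrammeKLRegimeEngineIsoTupleSmallnessV3
import Summits.HubbardSuperconductivity.HubbardSuperconductivity.Theorems.KLProgrammeKLRegimeEngineV8PairTransferExport7Shares

/-!
# K3 ENGINE package `G`-level v11: the class-#5 / class-#6 twins AT THE TOKEN `klEngGeo11` (plan g21 (R100)(3)(iii); cell gate-hubbard-kl, seat hubbard-kl-k3c2-p2 g14)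

WHAT.  Everything a (c)/(X) closer or the composition §C reads BY NAME at the G token, re-keyed from `klEngGeo10` (`…DefsG10Hosting`, `…Export6` §4,
`…IsoTupleSmallnessV3` §3–§4, `…DefsG10` §5) to `klEngGeo11 := klEngGeo10.addTwoShell klTSA` (Export7's class-#5 objects are keyed by their own author):
* §1 p1's class-#5 SAME-PACKAGE hosting lemmas at the token (one `rw [klEngGeo11_eq_addShellLog]` onto the `_sameShellLog` forms with
  `G := (klEngGeo8.raiseCF klE5CFM).addTwoShell klTSA`, `C := 2⁵²`): `transferBarRelAtWF_le_transferBarAt_klEngGeo11`, `transferBarRelIdx_le_transferBarAt_klEngGeo11`,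
  `pairTransferPinnedAt_compl_of_relIdx_klEngGeo11` (generic-`r` vocabulary; under (R103) «REL-DIRECT» the class-#5 consumer no longer hosts into
  `transferBarAt` — Export7's `PairTransferStep7 … G Gth` reads the relative family at the thermal key `klEngGeoTh` directly — so no `klCTpin` twin is stated here);
  instead the (R103) «REL-DIRECT» share line AT THE TOKEN: `two_pow_eighty_le_klEngGeo11_CF` and **`transferBarRelIdx_klCT7_le_slots_klEngGeo11`** (p1's
  `transferBarRelIdx_klCT7_le_slots` with `G := klEngGeo11`, `G₀ := (klEngGeo8.raiseCF klE5CFM).addTwoShell klTSA`);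
* §2 class #6: **`klE5M_fit_klEngGeo11`**, `isoTupleL1AtV17F_klEngGeo11_of_klE5M_hist`, the rows entry **`klE5RowsU11 P R := klE5RowsUG klEngGeo11 P (klEngQ9c P R)`**
  (`_pos`, `_eq`), `rowsSmallness_klEng11Q9c`, and STUB (c) CONJUNCT 4 at the rev-13 tokens **`isoTupleL1AtV17F_klEng11_of_hiso`** (modulo (c)'s (E2″-F)ₙ; U-rows
  `U ≤ klEngU₀10 P R c`, `U ≤ klE5uM P R`, `U ≤ klE5RowsU11 P R`).
U12b (k3c2-p1 lineage) keys its G-keyed `min` entries at this token: `klIsoMomU klEngGeo11 …`, `klE4UF klEngGeo11 …`, `klE5FrU klEngGeo11 R`, Export7's `klCTu7 …`,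
`klE5RowsU11 P R`, `klTSU R`.  Bookkeeping only; nothing about the model is asserted; nothing asserts superconductivity.
-/

noncomputable section

namespace Summit.HubbardSuperconductivity.HubbardSuperconductivity.Theorems.KLRegimeSplit

set_option linter.dupNamespace false -- summit = problem name (single-conjunct summit), D-0017

open Real Finset Literature.MathematicalPhysics.QuantumLattice Literature.Probability.LatticeModels
open Summit.HubbardSuperconductivity.HubbardSuperconductivity.Theorems.KLProgrammeLegKernels
open Summit.HubbardSuperconductivity.HubbardSuperconductivity.Theorems.DispersionFlow
open Summit.HubbardSuperconductivity.HubbardSuperconductivity.Theorems.EngineV8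

/-! ## §1 Class #5 hosting at `klEngGeo11` -/

section Hosting

variable {L : ℕ}

/-- **Hosting of the well-formed relative bar at `klEngGeo11`** (`0 ≤ P.Klam`, `0 ≤ r`, `r·c ≤ r′`, `r·c ≤ r′·2⁵²`, weights `0 ≤ ms ≤ c`, `ov ≤ c`). -/
theorem transferBarRelAtWF_le_transferBarAt_klEngGeo11 {P : SplitConsts} (hK : 0 ≤ P.Klam) {c r r' : ℝ} (hr : 0 ≤ r) (hrc : r * c ≤ r')
    (hrcC : r * c ≤ r' * 2 ^ 52) (β U : ℝ) (n : ℕ) {ms ov : ℝ} (hms0 : 0 ≤ ms) (hms : ms ≤ c) (hov : ov ≤ c) (Qm k k' : TorusSite 2 L) :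
    transferBarRelAtWF L klEngGeo11 P r β U n ms ov Qm k k' ≤ transferBarAt L klEngGeo11 P r' β U n Qm k k' := by
  rw [klEngGeo11_eq_addShellLog]
  exact transferBarRelAtWF_le_transferBarAt_sameShellLog klEngGeo8_raiseCF_addTwoShell_CF_nonneg klEngGeo8_raiseCF_addTwoShell_phGain_nonneg hK
    (by positivity) hr hrc hrcC β U n hms0 hms hov Qm k k'

/-- **Hosting of the index bar at `klEngGeo11`** (`0 ≤ P.Klam`, `0 ≤ r`, `2r·15367 ≤ r′`, `2r·15367 ≤ r′·2⁵²`). -/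
theorem transferBarRelIdx_le_transferBarAt_klEngGeo11 {P : SplitConsts} (hK : 0 ≤ P.Klam) {r r' : ℝ} (hr : 0 ≤ r) (hrc : 2 * r * 15367 ≤ r')
    (hrcC : 2 * r * 15367 ≤ r' * 2 ^ 52) (β U : ℝ) (n m' : ℕ) (Qm k k' : TorusSite 2 L) :
    transferBarRelIdx L klEngGeo11 P r β U n m' Qm k k' ≤ transferBarAt L klEngGeo11 P r' β U n Qm k k' := by
  rw [klEngGeo11_eq_addShellLog]
  exact transferBarRelIdx_le_transferBarAt_sameShellLog klEngGeo8_raiseCF_addTwoShell_CF_nonneg klEngGeo8_raiseCF_addTwoShell_phGain_nonneg hK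
    (by positivity) hr hrc hrcC β U n m' Qm k k'

/-- `2⁸⁰ ≤ klEngGeo11.CF`. -/
theorem two_pow_eighty_le_klEngGeo11_CF : (2 : ℝ) ^ 80 ≤ klEngGeo11.CF := two_pow_eighty_le_klEngGeo8_CF.trans klEngGeo8_CF_le_klEngGeo11_CF

/-- **(R103) «REL-DIRECT» AT THE TOKEN**: the inherited relative bar's SLOT SHARES at `(r, Gth) = (klCT7 P R Q₀ G′ klEngGeoTh, klEngGeoTh)` against the engine package
`klEngGeo11` — p1's `transferBarRelIdx_klCT7_le_slots` with `G := klEngGeo11 = ((klEngGeo8.raiseCF klE5CFM).addTwoShell klTSA).addShellLog 2⁵²`. -/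
theorem transferBarRelIdx_klCT7_le_slots_klEngGeo11 {P : SplitConsts} (hKl : 0 ≤ P.Klam) (R : RenConsts) (Q₀ : EngConsts) (G' : GeoConsts) (β U : ℝ) (n : ℕ)
    (Qm k k' : TorusSite 2 L) :
    transferBarRelIdx L klEngGeoTh P (klCT7 P R Q₀ G' klEngGeoTh) β U n n Qm k k' ≤
      (2 : ℝ)⁻¹ ^ 15 * ((P.Klam * U) ^ 2 * (klEngGeo11.phGain (n + 1) (klTorusNorm L (k - k')) + klEngGeo11.phGain (n + 1) (klTorusNorm L (k + k' - Qm)))) +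
        2 * klCT7 P R Q₀ G' klEngGeoTh * 15367 * ((P.Klam * U) ^ 2 * ((L : ℝ))⁻¹) +
        4 * klCT7 P R Q₀ G' klEngGeoTh * 15367 * ((P.Klam * |U|) ^ 3 * ((2 : ℝ) ^ (n + 1))⁻¹) +
        (2 : ℝ)⁻¹ ^ 5 * thermalBar klEngGeo11 P U β (n + 1) :=
  transferBarRelIdx_klCT7_le_slots klEngGeo11_eq_addShellLog klEngGeo8_raiseCF_addTwoShell_phGain_nonneg two_pow_eighty_le_klEngGeo11_CF hKl R Q₀ G' β U n
    Qm k k'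


variable {M : ℕ} [NeZero L] [NeZero M]

/-- **Step 3's history input with the family keyed AT `klEngGeo11`**: the pinned pair `(s_{n,m} | s_{n,n})` gives `PairTransferPinnedAt L M klEngGeo11 P r′ β U μ n (s_{n,m})`
(`0 ≤ P.Klam`, `0 ≤ r`, `2r·15367 ≤ r′`, `2r·15367 ≤ r′·2⁵²`). -/
theorem pairTransferPinnedAt_compl_of_relIdx_klEngGeo11 {P : SplitConsts} (hK : 0 ≤ P.Klam) {r r' β U μ : ℝ} (hr : 0 ≤ r) (hrc : 2 * r * 15367 ≤ r')
    (hrcC : 2 * r * 15367 ≤ r' * 2 ^ 52) {n m : ℕ}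
    (h : PairTransferRelAt L M β U μ n (transferBarRelIdx L klEngGeo11 P r β U n n)
      (softSymbolCompl L M β μ (klFlowFrameU L M β U μ n) n m) (softSymbolCompl L M β μ (klFlowFrameU L M β U μ n) n n)) :
    PairTransferPinnedAt L M klEngGeo11 P r' β U μ n (softSymbolCompl L M β μ (klFlowFrameU L M β U μ n) n m) :=
  pairTransferPinnedAt_compl_of_relIdx_of_le h fun Qm k k' => transferBarRelIdx_le_transferBarAt_klEngGeo11 hK hr hrc hrcC β U n n Qm k k'

end Hosting

/-! ## §2 Class #6 at `klEngGeo11`: the fit, the rows entry, input (III), stub (c) conjunct 4 -/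

/-- **The class-#6 fit at `klEngGeo11`**: `U ≤ klE5uM P R ⟹ klE5AM + 2·(klE5cM + klE5dM P R·Klam²·U) ≤ klEngGeo11.CF` (`P.WF`, `R.WF2`). -/
theorem klE5M_fit_klEngGeo11 {P : SplitConsts} {R : RenConsts} (hP : P.WF) (hR : R.WF2) {U : ℝ} (hU : U ≤ klE5uM P R) :
    klE5AM + 2 * (klE5cM + klE5dM P R * P.Klam ^ 2 * U) ≤ klEngGeo11.CF :=
  klE5M_fit hP hR klEngGeo8_CF_add_klE5CFM_le_klEngGeo11_CF hU

/-- **`klE5RowsU11 P R := klE5RowsUG klEngGeo11 P (klEngQ9c P R)`** — U12b's accumulated-rows entry at the rev-13 keys. -/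
def klE5RowsU11 (P : SplitConsts) (R : RenConsts) : ℝ := klE5RowsUG klEngGeo11 P (klEngQ9c P R)

/-- `klE5RowsU11 P R = klE5RowsUG klEngGeo11 P (klEngQ9c P R)` (`rfl`). -/
theorem klE5RowsU11_eq (P : SplitConsts) (R : RenConsts) : klE5RowsU11 P R = klE5RowsUG klEngGeo11 P (klEngQ9c P R) := rfl

/-- `0 < klE5RowsU11 P R`. -/
theorem klE5RowsU11_pos (P : SplitConsts) (R : RenConsts) : 0 < klE5RowsU11 P R := klE5RowsUG_pos _ _ _

/-- **Input (III) at the rev-13 keys** `(klEngGeo11, klEngQ9c P R)`: `0 < U ≤ klEngU₀10 P R c`, `U ≤ klE5RowsU11 P R`, `n ≤ n_β + 1`, `klEngL₄ P R β U ≤ L`. -/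
theorem rowsSmallness_klEng11Q9c (P : SplitConsts) (R : RenConsts) (hP : P.WF) {c β U : ℝ} (hβ : klBetaMin ≤ β) (hU : 0 < U)
    (hU10 : U ≤ klEngU₀10 P R c) (hUR : U ≤ klE5RowsU11 P R) {n L : ℕ} (hn : n ≤ nScales β + 1) (hL : klEngL₄ P R β U ≤ L) :
    initDevBar klEngGeo11 U + legDressBarQ2 klEngGeo11 P (klEngQ9c P R) U 0 4 +
        (3 * klEngGeo11.CF * (P.Klam * U) ^ 2 +
          ((klEngGeo11.cloc * P.Klam ^ 2 * (1 - (4 : ℝ) ^ (-klEngGeo11.θ))⁻¹ + 2 * (klEngQ9c P R).CR * P.Klam ^ 3 * |U|) * U ^ 2 +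
              ∑ j ∈ range n, (klEngQ9c P R).CL β j / L) +
            7 / 3 * (klEngGeo11.CF * (P.Klam * U) ^ 2) + 20 * ((klEngQ9c P R).CR * ((P.Klam * U) ^ 2 + (P.Klam * |U|) ^ 3)) +
              4 / 3 * ((klEngQ9c P R).CR * (P.Klam * U) ^ 2)) ≤ U / 2 :=
  rowsSmallness_of_le_klE5RowsUG klEngGeo11_wf P R hP (isRaiseOf_klEngQ9c_klEngQ8 P R) hβ hU hU10 hUR hn hL

section Closer

variable {L M : ℕ} [NeZero L] [NeZero M]

/-- **(E5-F)ₙ from the explicit class-#6 B line at `klEngGeo11`** (the W/B door's residual inputs verbatim). -/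
theorem isoTupleL1AtV17F_klEngGeo11_of_klE5M_hist {P : SplitConsts} {Q : EngConsts} {R : RenConsts} {β U μ : ℝ}
    (hP : P.WF) (hQ : Q.WF) (hR : R.WF2) (hU : 0 < U) {n : ℕ} (hn1 : 1 ≤ n) (hn : n ≤ nScales β + 1) (hUu : U ≤ klE5uM P R)
    (hline : IsoTupleLineBAt L M klE5AM klE5cM (klE5dM P R) P β U μ n)
    (hhist : HistP klPredsV17F2 L M klEngGeo11 P Q R β U μ 0 n) (hE2'' : PairValueIncrementAtV17F L M klEngGeo11 P Q β U μ n)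
    {q q₃ : TorusSite 2 L} (hq : q ∈ klBall L μ 0) (hq₃ : q₃ ∈ klBall L μ 0) (hqq : 4⁻¹ < klTorusNorm L (q + q₃))
    (hUκ : R.Gfr 0 * |U| ≤ 1 / 32 * klE0)
    (hsmall : initDevBar klEngGeo11 U + legDressBarQ2 klEngGeo11 P Q U 0 4 +
        (3 * klEngGeo11.CF * (P.Klam * U) ^ 2 +
          ((klEngGeo11.cloc * P.Klam ^ 2 * (1 - (4 : ℝ) ^ (-klEngGeo11.θ))⁻¹ + 2 * Q.CR * P.Klam ^ 3 * |U|) * U ^ 2 +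
            ∑ j ∈ range n, Q.CL β j / L) +
            7 / 3 * (klEngGeo11.CF * (P.Klam * U) ^ 2) + 20 * (Q.CR * ((P.Klam * U) ^ 2 + (P.Klam * |U|) ^ 3)) +
              4 / 3 * (Q.CR * (P.Klam * U) ^ 2)) ≤ U / 2) :
    IsoTupleL1AtV17F L M klEngGeo11 P β U μ n :=
  isoTupleL1AtV17F_of_klE5M_hist klEngGeo11_wf hP hQ hR hU klEngGeo8_CF_add_klE5CFM_le_klEngGeo11_CF hn1 hn hUu hline hhist hE2'' hq hq₃ hqq hUκ hsmall

/-- **STUB (c) CONJUNCT 4 at `(klEngGeo11, klEngQ9c P R)`** (`1 ≤ n ≤ n_β + 1`): the `hiso` binder at `j = n`, the history, the CURRENT (E2″-F)ₙ, and the U-rows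
`U ≤ klEngU₀10 P R c`, `U ≤ klE5uM P R`, `U ≤ klE5RowsU11 P R` (+ `klEngL₄ P R β U ≤ L`, `μ ∈ klWindowC`) ⟹ `IsoTupleL1AtV17F L M klEngGeo11 P β U μ n`. -/
theorem isoTupleL1AtV17F_klEng11_of_hiso (P : SplitConsts) (R : RenConsts) (hP : P.WF) (hR : R.WF2) {c μ U β : ℝ} (hμ : μ ∈ klWindowC)
    (hU : 0 < U) (hU10 : U ≤ klEngU₀10 P R c) (hUM : U ≤ klE5uM P R) (hUR : U ≤ klE5RowsU11 P R) (hβ : klBetaMin ≤ β)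
    (hL : klEngL₄ P R β U ≤ L) {n : ℕ} (hn1 : 1 ≤ n) (hn : n ≤ nScales β + 1)
    (hline : IsoTupleLineBAt L M klE5AM klE5cM (klE5dM P R) P β U μ n)
    (hhist : HistP klPredsV17F2 L M klEngGeo11 P (klEngQ9c P R) R β U μ 0 n)
    (hE2'' : PairValueIncrementAtV17F L M klEngGeo11 P (klEngQ9c P R) β U μ n) :
    IsoTupleL1AtV17F L M klEngGeo11 P β U μ n := by
  obtain ⟨q, hq, hqq⟩ := exists_mem_klBall_zero_diag_of_klEngL₃_le (L := L) hμ hβ (klEngL₃_le_of_klEngL₄_le hL)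
  have hUκ : R.Gfr 0 * |U| ≤ 1 / 32 * klE0 := (gfr0_mul_abs_le_of_le_klEngU₀10 hU hU10).trans_eq (by ring)
  exact isoTupleL1AtV17F_klEngGeo11_of_klE5M_hist hP ((isRaiseOf_klEngQ9c_klEngQ8 P R).wf (klEngQ8_wf P R)) hR hU hn1 hn hUM hline hhist hE2''
    hq hq hqq hUκ (rowsSmallness_klEng11Q9c P R hP hβ hU hU10 hUR hn hL)

end Closer

end Summit.HubbardSuperconductivity.HubbardSuperconductivity.Theorems.KLRegimeSplit

end
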